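import Mathlib
import Literature.NumberTheory.Transcendental.KZCalculusProofs
import Literature.NumberTheory.Transcendental.KZLogCalculusProofs
import Literature.NumberTheory.Transcendental.KZSemiCanonicalReductionProofs
import Literature.NumberTheory.Transcendental.KZSubcalculusInvariants
import Literature.NumberTheory.Transcendental.KZProductIdeal
import Literature.NumberTheory.Transcendental.KZSemialgebraicComplex
import Literature.NumberTheory.Transcendental.KZIdealTetrahedron
import Literature.NumberTheory.Transcendental.KZIntervalPeriodProofs
import Summits.KontsevichZagierPeriods.KontsevichZagierPeriods.Theorems.DihedralNormalForm.Negative.RuleTwoTightness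

/-!
# `OffTetraSectorKernel`, line `odd-hyperbolic-ladder`: Landen's identity (`stub_dilogLanden`)

Stub `stub_dilogLanden` of the crux `OffTetraSectorKernel` (stmt-KontsevichZagierPeriods-10557,
route HyperbolicBloch): LANDEN'S IDENTITY `−Li₂(−x/(1−x)) = Li₂(x) + ½ log²(1−x)` (`0 < x < 1`)
INSIDE the Kontsevich–Zagier calculus of moves. With `y = x/(1−x)`:
`My = [{0<v<u<y}, 1/(u(1+v))]` (`−Li₂(−y)`), `Lx = [{0<s<t<x}, 1/(t(1−s))]` (`Li₂(x)`),
`Qx = [{0<s<t<x}, 1/((1−t)(1−s))]` (`½ log²(1−x)`), `Sx = [(0,x)², 1/((1−t)(1−s))]` (`log²(1−x)`).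

* Part A (`[My] ≡ [Lx] + [Qx]`): the Möbius map `Φ(t,s) = (t/(1−t), s/(1−s))` is a bijection of
  `T = {0<s<t<x}` onto `{0<v<u<y}` with derivative `diag((1−t)⁻², (1−s)⁻²)`, and
  `[1/(u(1+v))](Φ(t,s))·|det Φ'| = 1/(t(1−t)(1−s)) = 1/(t(1−s)) + 1/((1−t)(1−s))`; with the
  auxiliary `R = [T, 1/(t(1−t)(1−s))]`, `[R] − [My]` is ONE change-of-variables move (rule (2))
  and `[R] − [Lx] − [Qx]` ONE integrand-additivity move (rule (1b)).
* Part B (`2[Qx] ≡ [Sx]`): `S = T ∪ (S ∖ T)` (rule (1a)); `S ∖ T` is the swapped triangle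
  `{0<t<s<x}` up to the null diagonal, and the swapped triangle with the symmetric integrand is
  the coordinate permutation `Qx.reindex (swap 0 1)` of `Qx` (rule (2)).

References: M. Kontsevich, D. Zagier, *Periods* (2001), §1.2 rules (1)–(2); J. Bochnak, M. Coste,
M.-F. Roy, *Real Algebraic Geometry* (1998), §2.2.
-/

noncomputable section

open Set MeasureTheory MvPolynomial
open Literature.NumberTheory.Transcendental Literature.ModelTheory.ExponentialFields

namespace Summit.KontsevichZagierPeriods.HyperbolicBloch.OffTetraSectorKernel

/-! ### Scalar facts about the Möbius map `t ↦ t/(1−t)` -/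

/-- `t ↦ t/(1−t)` is strictly increasing on `(−∞, 1)`. [folklore] -/
theorem dilogLanden_moebius_lt_iff {a b : ℝ} (ha : a < 1) (hb : b < 1) :
    a / (1 - a) < b / (1 - b) ↔ a < b := by
  rw [div_lt_div_iff₀ (sub_pos.2 ha) (sub_pos.2 hb)]
  constructor <;> intro h <;> nlinarith

/-- `t ↦ t/(1−t)` is injective on `(−∞, 1)`. [folklore] -/
theorem dilogLanden_moebius_inj {a b : ℝ} (ha : a < 1) (hb : b < 1)
    (h : a / (1 - a) = b / (1 - b)) : a = b := by
  rw [div_eq_div_iff (sub_pos.2 ha).ne' (sub_pos.2 hb).ne'] at h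
  linarith

/-- The inverse of `t ↦ t/(1−t)` is `u ↦ u/(1+u)`: `(u/(1+u)) / (1 − u/(1+u)) = u`. [folklore] -/
theorem dilogLanden_moebius_inv {u : ℝ} (hu : 0 < 1 + u) :
    u / (1 + u) / (1 - u / (1 + u)) = u := by
  have hu' : 1 + u ≠ 0 := hu.ne'
  have h : 1 - u / (1 + u) = 1 / (1 + u) := by
    rw [eq_div_iff hu', sub_mul, div_mul_cancel₀ _ hu']
    ring
  rw [h, div_div_eq_mul_div, div_one, div_mul_cancel₀ _ hu']

/-- The Jacobian identity behind rule (2) on the triangle (`t ≠ 0`, `t ≠ 1`, `s ≠ 1`):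
`1/(t(1−t)(1−s)) = [1/(u(1+v))](t/(1−t), s/(1−s)) · (1−t)⁻²(1−s)⁻²`. [folklore] -/
theorem dilogLanden_jacobian_identity {t s : ℝ} (ht : t ≠ 0) (ht1 : 1 - t ≠ 0)
    (hs1 : 1 - s ≠ 0) :
    1 / (t * (1 - t) * (1 - s)) =
      1 / (t / (1 - t) * (1 + s / (1 - s))) * (1 / (1 - t) ^ 2 * (1 / (1 - s) ^ 2)) := by
  have h1 : 1 + s / (1 - s) = 1 / (1 - s) := by
    rw [eq_div_iff hs1, add_mul, div_mul_cancel₀ _ hs1]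
    ring
  rw [h1]
  field_simp

/-- The partial-fraction identity behind rule (1b) (`t ≠ 0`, `t ≠ 1`, `s ≠ 1`):
`1/(t(1−t)(1−s)) = 1/(t(1−s)) + 1/((1−t)(1−s))`. [folklore] -/
theorem dilogLanden_partialFraction {t s : ℝ} (ht : t ≠ 0) (ht1 : 1 - t ≠ 0)
    (hs1 : 1 - s ≠ 0) :
    1 / (t * (1 - t) * (1 - s)) = 1 / (t * (1 - s)) + 1 / ((1 - t) * (1 - s)) := by
  field_simp
  ring

/-! ### The Möbius map `Φ(t,s) = (t/(1−t), s/(1−s))` of the plane -/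

/-- The coordinates of the Möbius map. [folklore] -/
theorem dilogLanden_map_apply (Φ : (Fin 2 → ℝ) → (Fin 2 → ℝ))
    (hΦ : ∀ p, Φ p = ![p 0 / (1 - p 0), p 1 / (1 - p 1)]) (p : Fin 2 → ℝ) (i : Fin 2) :
    Φ p i = p i / (1 - p i) := by
  rw [hΦ]
  fin_cases i <;> rfl

/-- The Möbius map is injective on `{t < 1, s < 1}`. [folklore] -/
theorem dilogLanden_map_injOn (Φ : (Fin 2 → ℝ) → (Fin 2 → ℝ))
    (hΦ : ∀ p, Φ p = ![p 0 / (1 - p 0), p 1 / (1 - p 1)]) :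
    InjOn Φ {p : Fin 2 → ℝ | p 0 < 1 ∧ p 1 < 1} := by
  intro a ha b hb h
  have hi : ∀ i, a i / (1 - a i) = b i / (1 - b i) := fun i => by
    rw [← dilogLanden_map_apply Φ hΦ a, ← dilogLanden_map_apply Φ hΦ b, h]
  funext i
  fin_cases i
  exacts [dilogLanden_moebius_inj ha.1 hb.1 (hi 0), dilogLanden_moebius_inj ha.2 hb.2 (hi 1)]

/-- The Möbius map is a `ℚ`-semialgebraic map on every `ℚ`-semialgebraic `σ ⊆ {t < 1, s < 1}`:
its coordinates are quotients of `ℚ`-polynomials with non-vanishing denominators.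
[cite: BochnakCosteRoy1998, §2.2] -/
theorem dilogLanden_map_isSemialgebraicMapOn (Φ : (Fin 2 → ℝ) → (Fin 2 → ℝ))
    (hΦ : ∀ p, Φ p = ![p 0 / (1 - p 0), p 1 / (1 - p 1)]) {σ : Set (Fin 2 → ℝ)}
    (hσ : IsSemialgebraic ℚ σ) (hsub : σ ⊆ {p | p 0 < 1 ∧ p 1 < 1}) :
    IsSemialgebraicMapOn ℚ σ Φ := by
  refine IsSemialgebraicMapOn.of_forall hσ fun j => ?_
  have hq : ∀ p ∈ σ, aeval p (1 - X j : MvPolynomial (Fin 2) ℚ) ≠ 0 := fun p hp => by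
    have hlt : p j < 1 := by
      fin_cases j
      exacts [(hsub hp).1, (hsub hp).2]
    simpa only [map_sub, map_one, MvPolynomial.aeval_X] using (sub_pos.2 hlt).ne'
  exact (isSemialgebraicFunOn_aeval_div_aeval hσ (X j) (1 - X j) hq).congr fun p _ => by
    simp [dilogLanden_map_apply Φ hΦ p j]

/-- **The image of the triangle `{0<s<t<x}` under the Möbius map** is the triangle
`{0<v<u<x/(1−x)}` (`x < 1`): monotonicity of `t ↦ t/(1−t)` and the inverse `u ↦ u/(1+u)`.
[folklore] -/
theorem dilogLanden_map_image (Φ : (Fin 2 → ℝ) → (Fin 2 → ℝ))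
    (hΦ : ∀ p, Φ p = ![p 0 / (1 - p 0), p 1 / (1 - p 1)]) {x : ℝ} (hx1 : x < 1) :
    Φ '' {w : Fin 2 → ℝ | 0 < w 1 ∧ w 1 < w 0 ∧ w 0 < x} =
      {w : Fin 2 → ℝ | 0 < w 1 ∧ w 1 < w 0 ∧ w 0 < x / (1 - x)} := by
  ext q
  constructor
  · rintro ⟨p, ⟨h1, h2, h3⟩, rfl⟩
    simp only [mem_setOf_eq, dilogLanden_map_apply Φ hΦ p]
    have hp0 : p 0 < 1 := by linarith
    have hp1 : p 1 < 1 := by linarith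
    exact ⟨div_pos h1 (sub_pos.2 hp1), (dilogLanden_moebius_lt_iff hp1 hp0).2 h2,
      (dilogLanden_moebius_lt_iff hp0 hx1).2 h3⟩
  · rintro ⟨h1, h2, h3⟩
    have hq0 : (0 : ℝ) < 1 + q 0 := by linarith
    have hq1 : (0 : ℝ) < 1 + q 1 := by linarith
    have h3' : q 0 * (1 - x) < x := (lt_div_iff₀ (sub_pos.2 hx1)).1 h3
    refine ⟨![q 0 / (1 + q 0), q 1 / (1 + q 1)], ?_, ?_⟩
    · simp only [mem_setOf_eq, Matrix.cons_val_zero, Matrix.cons_val_one]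
      refine ⟨div_pos h1 hq1, ?_, ?_⟩
      · rw [div_lt_div_iff₀ hq1 hq0]
        nlinarith
      · rw [div_lt_iff₀ hq0]
        nlinarith
    · rw [hΦ]
      funext i
      fin_cases i
      · simpa using dilogLanden_moebius_inv hq0
      · simpa using dilogLanden_moebius_inv hq1

/-- **The derivative of the Möbius map and its determinant.** At every point a linear map `L` of
matrix `diag((1−t)⁻², (1−s)⁻²)` (Lean's `1/0 = 0` convention off `{t ≠ 1, s ≠ 1}`), which is the
Fréchet derivative of `Φ` wherever `t ≠ 1`, `s ≠ 1`. [folklore] -/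
theorem dilogLanden_map_hasFDerivAt_det (Φ : (Fin 2 → ℝ) → (Fin 2 → ℝ))
    (hΦ : ∀ p, Φ p = ![p 0 / (1 - p 0), p 1 / (1 - p 1)]) (p : Fin 2 → ℝ) :
    ∃ L : (Fin 2 → ℝ) →L[ℝ] (Fin 2 → ℝ), (1 - p 0 ≠ 0 → 1 - p 1 ≠ 0 → HasFDerivAt Φ L p) ∧
      L.det = 1 / (1 - p 0) ^ 2 * (1 / (1 - p 1) ^ 2) := by
  have hd : ∀ t : ℝ, 1 - t ≠ 0 →
      HasDerivAt (fun s : ℝ => s / (1 - s)) (1 / (1 - t) ^ 2) t := fun t ht => by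
    refine ((hasDerivAt_id' t).fun_div ((hasDerivAt_id' t).const_sub 1) ht).congr_deriv ?_
    ring
  set M : Matrix (Fin 2) (Fin 2) ℝ := !![1 / (1 - p 0) ^ 2, 0; 0, 1 / (1 - p 1) ^ 2] with hM
  refine ⟨LinearMap.toContinuousLinearMap (Matrix.toLin' M), fun h0 h1 => ?_, ?_⟩
  · -- derivative, componentwise
    have hne : ∀ i : Fin 2, 1 - p i ≠ 0 := fun i => by fin_cases i <;> assumption
    refine hasFDerivAt_pi'' fun i => ?_
    have hf : (fun x => Φ x i) = (fun s : ℝ => s / (1 - s)) ∘ fun x : Fin 2 → ℝ => x i := by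
      funext x
      exact dilogLanden_map_apply Φ hΦ x i
    rw [hf]
    refine ((hd (p i) (hne i)).comp_hasFDerivAt p
      (hasFDerivAt_apply (𝕜 := ℝ) i p)).congr_fderiv ?_
    ext v
    fin_cases i <;> simp [hM, Matrix.toLin'_apply, dotProduct, Fin.sum_univ_two]
  · -- determinant
    rw [LinearMap.det_toContinuousLinearMap, LinearMap.det_toLin', hM, Matrix.det_fin_two_of]
    ring

/-! ### Part A: the Möbius move and the partial fractions -/

/-- **Part A of Landen's identity inside the calculus**: `[My] − [Lx] − [Qx] ∈ relations`. With
the auxiliary representation `R = [{0<s<t<x}, 1/(t(1−t)(1−s))]`, `[R] − [My]` is one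
change-of-variables move along the Möbius map and `[R] − [Lx] − [Qx]` is one integrand-additivity
move. [cite: KontsevichZagier2001, §1.2 rules (1), (2)] -/
theorem dilogLanden_partA {x : ℝ} (hx1 : x < 1) (My Lx Qx : KZ.IntegralRep 2)
    (hMy : My.domain = {w | 0 < w 1 ∧ w 1 < w 0 ∧ w 0 < x / (1 - x)})
    (hMyi : EqOn My.integrand (fun w => 1 / (w 0 * (1 + w 1))) My.domain)
    (hLx : Lx.domain = {w | 0 < w 1 ∧ w 1 < w 0 ∧ w 0 < x})
    (hLxi : EqOn Lx.integrand (fun w => 1 / (w 0 * (1 - w 1))) Lx.domain)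
    (hQx : Qx.domain = {w | 0 < w 1 ∧ w 1 < w 0 ∧ w 0 < x})
    (hQxi : EqOn Qx.integrand (fun w => 1 / ((1 - w 0) * (1 - w 1))) Qx.domain) :
    KZ.of My - KZ.of Lx - KZ.of Qx ∈ KZ.relations := by
  -- the Möbius map
  set Φ : (Fin 2 → ℝ) → (Fin 2 → ℝ) := fun p => ![p 0 / (1 - p 0), p 1 / (1 - p 1)]
  have hΦ : ∀ p, Φ p = ![p 0 / (1 - p 0), p 1 / (1 - p 1)] := fun _ => rfl
  -- bounds on the triangle `T = Lx.domain = Qx.domain`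
  have hLQ : Lx.domain = Qx.domain := hLx.trans hQx.symm
  have hT : ∀ w ∈ Lx.domain, 0 < w 0 ∧ w 0 < 1 ∧ w 1 < 1 := fun w hw => by
    rw [hLx] at hw
    obtain ⟨h1, h2, h3⟩ := hw
    exact ⟨by linarith, by linarith, by linarith⟩
  have hne : ∀ w ∈ Lx.domain, w 0 ≠ 0 ∧ 1 - w 0 ≠ 0 ∧ 1 - w 1 ≠ 0 := fun w hw =>
    ⟨(hT w hw).1.ne', (sub_pos.2 (hT w hw).2.1).ne', (sub_pos.2 (hT w hw).2.2).ne'⟩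
  have hsub : Lx.domain ⊆ {p | p 0 < 1 ∧ p 1 < 1} := fun w hw => (hT w hw).2
  have hmeas : MeasurableSet Lx.domain := KZ.IntegralRep.measurableSet_domain_holds Lx
  -- EXISTENCE of the auxiliary representation `R = [T, 1/(t(1−t)(1−s))]`
  have hRsa : IsSemialgebraicFunOn ℚ Lx.domain
      (fun w => 1 / (w 0 * (1 - w 0) * (1 - w 1))) := by
    have hq : ∀ w ∈ Lx.domain,
        aeval w (X 0 * (1 - X 0) * (1 - X 1) : MvPolynomial (Fin 2) ℚ) ≠ 0 := by
      intro w hw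
      obtain ⟨ha, hb, hc⟩ := hne w hw
      simpa only [map_mul, map_sub, map_one, MvPolynomial.aeval_X] using
        mul_ne_zero (mul_ne_zero ha hb) hc
    exact (isSemialgebraicFunOn_aeval_div_aeval Lx.isSemialgebraic_domain 1 _ hq).congr
      fun w _ => by simp
  have hRint : IntegrableOn (fun w => 1 / (w 0 * (1 - w 0) * (1 - w 1))) Lx.domain := by
    have i1 : IntegrableOn (fun w => 1 / (w 0 * (1 - w 1))) Lx.domain :=
      Lx.integrableOn.congr_fun hLxi hmeas
    have i2 : IntegrableOn (fun w => 1 / ((1 - w 0) * (1 - w 1))) Lx.domain := by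
      rw [hLQ]
      exact Qx.integrableOn.congr_fun hQxi (KZ.IntegralRep.measurableSet_domain_holds Qx)
    refine IntegrableOn.congr_fun (i1.add i2) (fun w hw => ?_) hmeas
    obtain ⟨ha, hb, hc⟩ := hne w hw
    exact (dilogLanden_partialFraction ha hb hc).symm
  obtain ⟨R, hRd, hRi⟩ : ∃ R : KZ.IntegralRep 2, R.domain = Lx.domain ∧
      R.integrand = fun w => 1 / (w 0 * (1 - w 0) * (1 - w 1)) :=
    ⟨⟨Lx.domain, _, Lx.isSemialgebraic_domain, hRsa, hRint⟩, rfl, rfl⟩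
  -- the data of the move
  have hΦsa : IsSemialgebraicMapOn ℚ R.domain Φ := by
    rw [hRd]
    exact dilogLanden_map_isSemialgebraicMapOn Φ hΦ Lx.isSemialgebraic_domain hsub
  have hinj : InjOn Φ R.domain := by
    rw [hRd]
    exact (dilogLanden_map_injOn Φ hΦ).mono hsub
  choose Φ' hΦ'd hΦ'det using dilogLanden_map_hasFDerivAt_det Φ hΦ
  have hderiv : ∀ w ∈ R.domain, HasFDerivWithinAt Φ (Φ' w) R.domain w := fun w hw =>
    (hΦ'd w (hne w (hRd ▸ hw)).2.1 (hne w (hRd ▸ hw)).2.2).hasFDerivWithinAt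
  have himage : My.domain = Φ '' R.domain := by
    rw [hRd, hLx, hMy]
    exact (dilogLanden_map_image Φ hΦ hx1).symm
  -- rule (2): `[R] − [My]` is one change-of-variables move
  have hRM : KZ.of R - KZ.of My ∈ KZ.relations := by
    refine KZ.changeOfVariablesRel_subset_relations
      ⟨2, R, My, Φ, Φ', hΦsa, hderiv, hinj, himage, fun w hw => ?_, rfl⟩
    have hw' : w ∈ Lx.domain := hRd ▸ hw
    have hwM : Φ w ∈ My.domain := himage ▸ mem_image_of_mem Φ hw
    obtain ⟨ha, hb, hc⟩ := hne w hw'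
    have hpos : 0 < 1 / (1 - w 0) ^ 2 * (1 / (1 - w 1) ^ 2) :=
      mul_pos (one_div_pos.2 (pow_pos (sub_pos.2 (hT w hw').2.1) 2))
        (one_div_pos.2 (pow_pos (sub_pos.2 (hT w hw').2.2) 2))
    rw [hRi, hMyi hwM, hΦ'det w, abs_of_pos hpos]
    show 1 / (w 0 * (1 - w 0) * (1 - w 1)) =
      1 / (Φ w 0 * (1 + Φ w 1)) * (1 / (1 - w 0) ^ 2 * (1 / (1 - w 1) ^ 2))
    rw [dilogLanden_map_apply Φ hΦ w 0, dilogLanden_map_apply Φ hΦ w 1]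
    exact dilogLanden_jacobian_identity ha hb hc
  -- rule (1b): `[R] − [Lx] − [Qx]` is one integrand-additivity move
  have hRLQ : KZ.of R - KZ.of Lx - KZ.of Qx ∈ KZ.relations := by
    refine KZ.integrandAddRel_subset_relations
      ⟨2, R, Lx, Qx, hRd.symm, hLQ.symm.trans hRd.symm, fun w hw => ?_, rfl⟩
    have hw' : w ∈ Lx.domain := hRd ▸ hw
    obtain ⟨ha, hb, hc⟩ := hne w hw'
    rw [hRi, Pi.add_apply, hLxi hw', hQxi (hLQ ▸ hw')]
    exact dilogLanden_partialFraction ha hb hc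
  -- assemble
  have hsum : KZ.of My - KZ.of Lx - KZ.of Qx =
      (KZ.of R - KZ.of Lx - KZ.of Qx) - (KZ.of R - KZ.of My) := by abel
  rw [hsum]
  exact KZ.relations.sub_mem hRLQ hRM

/-! ### Part B: the square is twice the triangle -/

/-- **Part B of Landen's identity inside the calculus**: `2·[Qx] − [Sx] ∈ relations`. The square
`(0,x)²` is the triangle `T = {0<s<t<x}` plus `S ∖ T` (rule (1a)); `[T, ·]` is congruent to `Qx`;
`S ∖ T` is the swapped triangle `{0<t<s<x}` up to the null diagonal, and the swapped triangle with
the symmetric integrand `1/((1−t)(1−s))` is the coordinate permutation `Qx.reindex (swap 0 1)` of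
`Qx` (rule (2)). [cite: KontsevichZagier2001, §1.2 rules (1), (2)] -/
theorem dilogLanden_partB {x : ℝ} (Qx Sx : KZ.IntegralRep 2)
    (hQx : Qx.domain = {w | 0 < w 1 ∧ w 1 < w 0 ∧ w 0 < x})
    (hQxi : EqOn Qx.integrand (fun w => 1 / ((1 - w 0) * (1 - w 1))) Qx.domain)
    (hSx : Sx.domain = {w | 0 < w 0 ∧ w 0 < x ∧ 0 < w 1 ∧ w 1 < x})
    (hSxi : EqOn Sx.integrand (fun w => 1 / ((1 - w 0) * (1 - w 1))) Sx.domain) :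
    2 • KZ.of Qx - KZ.of Sx ∈ KZ.relations := by
  have hTS : Qx.domain ⊆ Sx.domain := by
    rw [hQx, hSx]
    rintro w ⟨h1, h2, h3⟩
    exact ⟨by linarith, h3, h1, by linarith⟩
  have hdiff : IsSemialgebraic ℚ (Sx.domain \ Qx.domain) :=
    Sx.isSemialgebraic_domain.diff Qx.isSemialgebraic_domain
  -- the two pieces of the square
  obtain ⟨Q1, hQ1d, hQ1i⟩ : ∃ Q1 : KZ.IntegralRep 2, Q1.domain = Qx.domain ∧
      Q1.integrand = Sx.integrand :=
    ⟨Sx.restrict Qx.domain Qx.isSemialgebraic_domain hTS, rfl, rfl⟩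
  obtain ⟨Q2, hQ2d, hQ2i⟩ : ∃ Q2 : KZ.IntegralRep 2, Q2.domain = Sx.domain \ Qx.domain ∧
      Q2.integrand = Sx.integrand :=
    ⟨Sx.restrict (Sx.domain \ Qx.domain) hdiff sdiff_subset, rfl, rfl⟩
  -- rule (1a): `[Sx] − [Q1] − [Q2]` is one domain-additivity move
  have h1 : KZ.of Sx - KZ.of Q1 - KZ.of Q2 ∈ KZ.relations := by
    refine KZ.domainAddRel_subset_relations
      ⟨2, Sx, Q1, Q2, ?_, ?_, fun w _ => by rw [hQ1i], fun w _ => by rw [hQ2i], rfl⟩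
    · rw [hQ1d, hQ2d]
      exact (union_sdiff_cancel hTS).symm
    · rw [hQ1d, hQ2d, inter_sdiff_self, measure_empty]
  -- congruence: `[Q1] − [Qx]`
  have h2 : KZ.of Q1 - KZ.of Qx ∈ KZ.relations := by
    refine KZ.of_sub_of_mem_relations_of_eqOn hQ1d.symm fun w hw => ?_
    rw [hQ1d] at hw
    rw [hQ1i]
    exact (hSxi (hTS hw)).trans (hQxi hw).symm
  -- the coordinate swap: `[Qx] − [Qx.reindex e]`
  set e : Fin 2 ≃ Fin 2 := Equiv.swap (0 : Fin 2) 1 with he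
  have he0 : e 0 = 1 := by rw [he, Equiv.swap_apply_left]
  have he1 : e 1 = 0 := by rw [he, Equiv.swap_apply_right]
  have hRd : (Qx.reindex e).domain = {w | 0 < w 0 ∧ w 0 < w 1 ∧ w 1 < x} := by
    rw [KZ.IntegralRep.reindex_domain, hQx]
    ext w
    simp only [mem_setOf_eq, he0, he1]
  obtain ⟨QR, hQRd, hQRi, h3⟩ : ∃ QR : KZ.IntegralRep 2,
      QR.domain = {w | 0 < w 0 ∧ w 0 < w 1 ∧ w 1 < x} ∧
      (QR.integrand = fun w => Qx.integrand fun i => w (e i)) ∧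
      KZ.of Qx - KZ.of QR ∈ KZ.relations :=
    ⟨Qx.reindex e, hRd, rfl, KZ.of_sub_of_reindex_mem_relations Qx e⟩
  -- null modification: `[Q2] − [QR]` (the domains differ by the null diagonal)
  have h4 : KZ.of Q2 - KZ.of QR ∈ KZ.relations := by
    refine KZ.of_sub_of_mem_relations_of_null Q2 QR ?_ ?_ ?_
    · rw [hQ2d, hQRd, hSx, hQx]
      -- the diagonal `{s = t}` is null (landed: `DihedralNormalForm.Negative.RuleTwoTightness`)
      refine measure_mono_null (fun w hw => ?_)
        DihedralNormalForm.Negative.volume_setOf_apply_one_eq_apply_zero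
      simp only [mem_sdiff, mem_setOf_eq, not_and, not_lt] at hw
      obtain ⟨⟨⟨g1, g2, g3, g4⟩, hT⟩, hT'⟩ := hw
      show w 1 = w 0
      rcases lt_trichotomy (w 1) (w 0) with hlt | heq | hgt
      · exact absurd g2 (not_lt.2 (hT g3 hlt))
      · exact heq
      · exact absurd g4 (not_lt.2 (hT' g1 hgt))
    · have hsub : {w : Fin 2 → ℝ | 0 < w 0 ∧ w 0 < w 1 ∧ w 1 < x} ⊆ Sx.domain \ Qx.domain := by
        rw [hSx, hQx]
        rintro w ⟨g1, g2, g3⟩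
        exact ⟨⟨g1, by linarith, by linarith, g3⟩, fun h => by linarith [h.2.1]⟩
      rw [hQ2d, hQRd, sdiff_eq_empty.mpr hsub, measure_empty]
    · intro w hw
      rw [hQ2d, hQRd] at hw
      obtain ⟨⟨hwS, -⟩, hwT'⟩ := hw
      have hwT : (fun i => w (e i)) ∈ Qx.domain := by
        rw [hQx]
        simpa only [mem_setOf_eq, he0, he1] using hwT'
      rw [hQ2i, hQRi]
      show Sx.integrand w = Qx.integrand fun i => w (e i)
      rw [hSxi hwS, hQxi hwT]
      simp only [he0, he1]
      ring
  -- assemble: `2[Qx] − [Sx] = ([Qx] − [QR]) − ([Sx] − [Q1] − [Q2]) − ([Q1] − [Qx]) − ([Q2] − [QR])`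
  have hsum : 2 • KZ.of Qx - KZ.of Sx = (KZ.of Qx - KZ.of QR) - (KZ.of Sx - KZ.of Q1 - KZ.of Q2) -
      (KZ.of Q1 - KZ.of Qx) - (KZ.of Q2 - KZ.of QR) := by abel
  rw [hsum]
  exact KZ.relations.sub_mem (KZ.relations.sub_mem (KZ.relations.sub_mem h3 h1) h2) h4

/-! ### The stub -/

/-- STUB `stub_dilogLanden`: LANDEN'S IDENTITY `−Li₂(−x/(1−x)) = Li₂(x) + ½ log²(1−x)` INSIDE THE
CALCULUS, for real algebraic `0 < x < 1`: the Möbius map `(t,s) ↦ (t/(1−t), s/(1−s))` carries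
`{0<s<t<x}` onto `{0<v<u<x/(1−x)}` (Jacobian `1/((1−t)²(1−s)²)`; rule (2)) and pulls
`du dv/(u(1+v))` back to `1/(t(1−t)(1−s)) = 1/(t(1−s)) + 1/((1−t)(1−s))` (rule (1b)); and twice
the triangle `[{0<s<t<x}, 1/((1−t)(1−s))]` is the square `[(0,x)², 1/((1−t)(1−s))]` (diagonal
null, swap symmetry; rules (1a), (2)), whose value is `log²(1−x)`.
[cite: KontsevichZagier2001, §1.2] -/
theorem stub_dilogLanden :
    ∀ (x : ℝ), IsAlgebraic ℚ x → 0 < x → x < 1 →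
    ∀ (My Lx Qx Sx : KZ.IntegralRep 2),
      My.domain = {w | 0 < w 1 ∧ w 1 < w 0 ∧ w 0 < x / (1 - x)} →
      Set.EqOn My.integrand (fun w => 1 / (w 0 * (1 + w 1))) My.domain →
      Lx.domain = {w | 0 < w 1 ∧ w 1 < w 0 ∧ w 0 < x} →
      Set.EqOn Lx.integrand (fun w => 1 / (w 0 * (1 - w 1))) Lx.domain →
      Qx.domain = {w | 0 < w 1 ∧ w 1 < w 0 ∧ w 0 < x} →
      Set.EqOn Qx.integrand (fun w => 1 / ((1 - w 0) * (1 - w 1))) Qx.domain →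
      Sx.domain = {w | 0 < w 0 ∧ w 0 < x ∧ 0 < w 1 ∧ w 1 < x} →
      Set.EqOn Sx.integrand (fun w => 1 / ((1 - w 0) * (1 - w 1))) Sx.domain →
      KZ.of My - KZ.of Lx - KZ.of Qx ∈ KZ.relations ∧ 2 • KZ.of Qx - KZ.of Sx ∈ KZ.relations := by
  intro x _ _ hx1 My Lx Qx Sx hMy hMyi hLx hLxi hQx hQxi hSx hSxi
  exact ⟨dilogLanden_partA hx1 My Lx Qx hMy hMyi hLx hLxi hQx hQxi,
    dilogLanden_partB Qx Sx hQx hQxi hSx hSxi⟩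

end Summit.KontsevichZagierPeriods.HyperbolicBloch.OffTetraSectorKernel

end
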